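import Literature.MathematicalPhysics.QuantumFieldTheory.BalabanImbrieJaffe1984to88.BIJ85ScalarPropagatorSupDecay
import Literature.MathematicalPhysics.QuantumFieldTheory.BalabanImbrieJaffe1984to88.BIJ88DeltaLocFlatClose235

/-!
# `BalabanImbrieJaffe1984to88.BIJ88DeltaRegionSmallField236` — T. Bałaban, J. Imbrie, A. Jaffe, *Effective action and cluster properties of
the abelian Higgs model*, Commun. Math. Phys. **114** (1988) 257–315 [BalabanImbrieJaffe1988], §2 (2.36) p. 263 [PDF 7]: **THE KERNEL OF THE
WHOLE-TORUS REGION FORM `Δ_k(T,u) = a_kI − a_k²Q_k(u)G_k(T,u)Q_k^*(u)` DECAYS EXPONENTIALLY AT EVERY NON-FLAT SMALL FIELD — the first NON-FLAT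
located member of the (2.30)–(2.41) chain on the torus** (`d ≤ 3`, `k`-uniform, level-`k` units): r18 g19's flat theorem
`BIJ88NeumannPropagatorFlatDecayLevel.decay236_torus_flat_level` with p27 g32's `BIJ85ScalarPropagatorSupDecay.decay110_smallField` — [7] (1.10)
value member for `G_k(T,u)` at non-flat small fields (Kato's inequality + p33's Agmon bound + tilted free rows; gauge-blind) — as the
propagator input in place of p38/r01's zero-field theorem, and gen 17's block-sum sandwich by name.

statement-level skeleton of published theorems with citation tags; proofs where landed; nothing here is a claim about the Yang–Mills mass gap

PDF held: `paper:balaban1988-cmp114-bij-abelian-higgs-effective-action` (journal page = PDF page + 256; p. 263 = PDF 7, p. 264 = PDF 8; renders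
`HOME/lit-balaban-p31/renders/original-p007-x2.png`, `…-p008-x2.png`).

CITATION HEADER (lean-in-tree rule).  lit-balaban cell (HOME `run/shared/lean/pub/lit-balaban/`), Phase 2, seat p31 gen 19 (unit `lit-balaban-p31`,
literature-prover-lit-balaban-p31-g19-0), free-target protocol G.5-34(d), TAKING line HOME/STATUS.md 2026-08-22T21:4xZ (stem check: no
`…SmallField…`/`…236…` stem on (2.36); courtesy notices r18, p27).  Row of `HOME/lit-balaban-r18/ROWS-C2.md` (owner r18, referee ref-5):
**C2.Eq2.36** (head = p02's hence-step `BIJ88OpDecay230Proof`/model level; flat located members gen 17 `BIJ88DeltaLocFlatClose235.decay236_*`,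
r18 `decay236_torus_flat_level`) — here the located member AT NON-FLAT SMALL FIELDS for `Ω = T` (cells only, no head change).  Files USED BY
NAME, nothing restated: p27's `BIJ85ScalarPropagatorSupDecay.decay110_smallField` (p341384), gen 15's `BIJ88DeltaLoc234Torus.deltaRegion`/`qMatT`,
`BIJ88NeumannPropagator227Torus.gBox`, gen 17's `BIJ88DeltaLocFlatClose235` (`norm_qMq_apply_le`, `norm_conj_qMatT_le`, `conj_qMatT_ne_zero`,
`blockLower_le_T`, `exp_blockLower_level_le`, `scale_identity`, `norm_coe_mul_one_apply`, `deltaRegion_apply`), p03's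
`B3Bound323ZeroTorus.T_eq_supDist`, p33's `BIJ85AbelianStokes.plaqC`, pv07's `B1RG242Torus.α`, `B1.aSeq`, p38's `B5Ineq137Torus.T`.

## The print (verbatim, p. 263–264)

p. 263: *"We use G_{k,loc} to define a localized quadratic form for scalar fields, Δ_{k,loc}(u) = a_kI − a_k²Q_k(u)G_{k,loc}(u)Q_k^*(u). (2.34)
Here we have simply replaced G_k(Ω, u) with G_{k,loc} in the definition of Δ_k(Ω, u); see (I.4.6.4). Hence … |Δ_k(u; x₁, x₂)| ≤ ce^{−c|x₁−x₂|},
(2.36)"*; p. 264: *"Again we assume u is smooth in the relevant regions"*.  [I] p. 326 (7.3.1): the small-field restriction on the gauge field.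

## What is proved (one theorem; 0 definitions; 0 `sorry`; no `Prop`-valued fact; standard axioms)

**`decay236_torus_smallField_level`** — for `1 ≤ d ≤ 3`, `L` odd `> 1`, `a > 0` there are `δ₀, c₀ > 0` such that on every torus of the model, at
every level `1 ≤ k ≤ K`, for every `U(1)` field `u` with `‖u(∂p) − 1‖ ≤ θ` at every plaquette and `2d³(L^{2k}θ)² ≤ 1` (p33's block-scale plaquette
smallness, the form in which p27's propagator member is stated), and all `y₁, y₂ ∈ T^{(k)}`:
`‖Δ_k(T,u)(y₁,y₂)‖ ≤ A·([y₁ = y₂] + a_k·c₀·e^{−δ₀|y₁−y₂|_{T^{(k)}}})`, `A = α_k(a)L^{kd}` (gen 15's counting normalization `deltaRegion A ε⁻¹ u k T =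
(A/a_k)×` printed `Δ_k(T,u)`), `|·|_{T^{(k)}}` the sup torus distance of the unit lattice — i.e. (2.36) with the printed `c` split into rate and
prefactor.  MECHANISM (r18's, verbatim up to the input swap): entry of `Δ_k = A·1 − A²·Q_kG_kQ_kᴴ` (`deltaRegion_apply`); the sandwich
`‖(Q_kG_kQ_kᴴ)(y₁,y₂)‖ ≤ B` from `‖(G_kg_{y₂})(x)‖ ≤ B` on the block of `y₁` (`norm_qMq_apply_le`) for the column source `g_{y₂} = conj Q_k(u)(y₂,·)`
(`‖g‖ ≤ L^{−kd}`, supported in `B^k(y₂)` at block lower distance `max(0, L^k|y₁−y₂| − (L^k−1))` by `blockLower_le_T`); p27's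
`‖(G_k(T,u)g)(x)‖ ≤ c₀(L^kε)²e^{−δ₀D/L^k}‖g‖_∞`; the scale identity `A²L^{−kd}(L^kε)² = A·a_k`; `exp_blockLower_level_le` (one block costs `e^{δ₀}`).
HONEST SCOPE.  (i) `Ω = T` only (the whole-torus region form; no Neumann sub-domains `G_k(□,u)`, hence no non-flat `Δ_{k,loc}` yet — that needs
[7]'s box theorem at non-flat fields); (ii) `d ≤ 3`, `L` odd (p27's tilted row bound and p33's block conventions); (iii) the smallness hypothesis is
p33's block-scale plaquette condition — that the printed (7.3.1)/(2.32) regime implies it for the background of record is p33's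
`BIJ85Claim73PropagatorDecay`, not restated; (iv) value member only (no derivative/Hölder statement); constants `(δ₀, c₀e^{δ₀})` from p27's, depending
on `(d, L, a)` only.  Imports: p27's `BIJ85ScalarPropagatorSupDecay`, gen 17's `BIJ88DeltaLocFlatClose235`.  Literature + Mathlib only.  Unit
`lit-balaban-p31` (literature-prover-lit-balaban-p31-g19-0), 2026-08-22.  NOT summit progress.
-/

open scoped BigOperators Matrix ComplexConjugate
open Finset Matrix

namespace Literature.MathematicalPhysics.QuantumFieldTheory.BalabanImbrieJaffe1984to88.BIJ88DeltaRegionSmallField236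

open Literature.MathematicalPhysics.QuantumFieldTheory.Balaban1983to89
open LatticeFieldCalculus (supDist)
open BIJ88Sect3Statements (U1)
open BIJ85BlockAveragesTorus BIJ85BlockAveragesTorusK
open BIJ85AbelianStokes (plaqC)
open BIJ88NeumannPropagator227Torus (gBox)
open BIJ88DeltaLoc234Torus (qMatT deltaRegion)
open BIJ88DeltaLocFlatClose235 (norm_qMq_apply_le norm_conj_qMatT_le conj_qMatT_ne_zero blockLower_le_T scale_identity
  norm_coe_mul_one_apply deltaRegion_apply exp_blockLower_level_le)
open BIJ85ScalarPropagatorSupDecay (decay110_smallField)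

noncomputable section

variable {P : Params}

/-- **(2.36) FOR THE WHOLE-TORUS REGION FORM `Δ_k(T,u)` AT EVERY NON-FLAT SMALL FIELD, `k`-UNIFORM, LEVEL-`k` UNITS** (*"|Δ_k(u; x₁, x₂)| ≤
ce^{−c|x₁−x₂|}, (2.36)"*, p. 263; p. 264 *"Again we assume u is smooth in the relevant regions"*): for `1 ≤ d ≤ 3`, `L` odd `> 1`, `a > 0` there are
`δ₀, c₀ > 0` such that for every torus of the model, every level `1 ≤ k ≤ K`, every `U(1)` field `u` with p33's block-scale plaquette
smallness `‖u(∂p) − 1‖ ≤ θ`, `2d³(L^{2k}θ)² ≤ 1`, and all `y₁, y₂ ∈ T^{(k)}`: the entries of gen 15's region form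
`Δ_k(T,u) = A·1 − A²Q_k(u)G_k(T,u)Q_k(u)ᴴ` (`A = α_k(a)L^{kd}` the counting normalization) obey
`‖Δ_k(T,u)(y₁,y₂)‖ ≤ A·([y₁ = y₂] + a_k·c₀·e^{−δ₀|y₁−y₂|_{T^{(k)}}})` — r18 g19's flat `decay236_torus_flat_level` with p27 g32's
`BIJ85ScalarPropagatorSupDecay.decay110_smallField` ([7] (1.10) value member at non-flat small fields; Kato + Agmon + tilted rows, gauge-blind) as
the propagator input in place of the zero-field theorem, gen 17's block-sum sandwich `norm_qMq_apply_le` / block lower bound `blockLower_le_T` /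
`exp_blockLower_level_le` / `scale_identity` by name. [cite: BalabanImbrieJaffe1988, (2.36) p.263] -/
theorem decay236_torus_smallField_level (d L : ℕ) (hd : 1 ≤ d) (hd3 : d ≤ 3) (hL : Odd L ∧ 1 < L) {a : ℝ} (ha : 0 < a) :
    ∃ δ₀ c₀ : ℝ, 0 < δ₀ ∧ 0 < c₀ ∧ ∀ (P : Params), P.d = d → P.L = L →
      ∀ k : ℕ, 1 ≤ k → k ≤ P.K → ∀ (U : GaugeField P 0 U1) (θ : ℝ),
        (∀ (y : Balaban1983to89.Site P 0) (μ ν : Fin P.d), ‖plaqC U y μ ν - 1‖ ≤ θ) →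
        2 * (P.d : ℝ) ^ 3 * (((P.L : ℝ) ^ k) ^ 2 * θ) ^ 2 ≤ 1 →
        ∀ y₁ y₂ : Balaban1983to89.Site P (0 + k),
          ‖deltaRegion (B1RG242Torus.α P a k * (P.L : ℝ) ^ (k * P.d)) P.eps⁻¹ U k univ y₁ y₂‖ ≤
            (B1RG242Torus.α P a k * (P.L : ℝ) ^ (k * P.d)) *
              ((if y₁ = y₂ then 1 else 0) + B1.aSeq a P.L k * c₀ * Real.exp (-(δ₀ * B5Ineq137Torus.T P (0 + k) y₁ y₂))) := by
  obtain ⟨δ₀, c₀, hδ₀, hc₀, H⟩ := decay110_smallField d L hd hd3 hL ha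
  refine ⟨δ₀, c₀ * Real.exp δ₀, hδ₀, by positivity, ?_⟩
  intro P hPd hPL k hk1 hkK U θ hθ hsmall y₁ y₂
  have hk : 0 + k ≤ P.m + P.K := by omega
  obtain ⟨A, hAdef⟩ : ∃ x : ℝ, x = B1RG242Torus.α P a k * (P.L : ℝ) ^ (k * P.d) := ⟨_, rfl⟩
  have hak : 0 < B1.aSeq a P.L k := B1.aSeq_pos ha (B1RG242Torus.one_lt_cast_L P) hk1
  have hα : 0 < B1RG242Torus.α P a k := mul_pos hak (inv_pos.mpr (pow_pos (P.spacing_pos k) 2))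
  have hA0 : 0 ≤ A := by rw [hAdef]; exact (mul_pos hα (pow_pos P.cast_L_pos _)).le
  obtain ⟨Dl, hDldef⟩ : ∃ x : ℝ, x = max 0 (((P.L : ℝ) ^ k) * B5Ineq137Torus.T P (0 + k) y₁ y₂ - (((P.L : ℝ) ^ k) - 1)) := ⟨_, rfl⟩
  have hDl0 : 0 ≤ Dl := by rw [hDldef]; exact le_max_left _ _
  -- the sandwich: the propagator input at non-flat small fields on the block row of `y₁` against the column source of `y₂`
  have hSandwich : ‖(qMatT U k * gBox A P.eps⁻¹ U k univ * (qMatT U k)ᴴ) y₁ y₂‖ ≤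
      c₀ * P.spacing k ^ 2 * Real.exp (-(δ₀ * Dl / (P.L : ℝ) ^ k)) * ((P.L : ℝ) ^ (k * P.d))⁻¹ := by
    rw [hAdef]
    exact norm_qMq_apply_le hk U _ y₁ y₂ fun x hx =>
      H P hPd hPL k hk1 hkK U θ hθ hsmall x _ _ Dl (fun x' => norm_conj_qMatT_le U k y₂ x')
        (fun x' hx' => by
          rw [hDldef, ← B3Bound323ZeroTorus.T_eq_supDist]
          exact blockLower_le_T hk hx (conj_qMatT_ne_zero U k hx'))
  have hexp : Real.exp (-(δ₀ * Dl / (P.L : ℝ) ^ k)) ≤ Real.exp δ₀ * Real.exp (-(δ₀ * B5Ineq137Torus.T P (0 + k) y₁ y₂)) := by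
    have e : -(δ₀ * Dl / (P.L : ℝ) ^ k) = -(δ₀ * (((P.L : ℝ) ^ k)⁻¹ * Dl)) := by ring
    rw [e, hDldef]
    exact exp_blockLower_level_le y₁ y₂ hδ₀.le
  rw [deltaRegion_apply, ← hAdef]
  calc ‖(A : ℂ) * (1 : Matrix _ _ ℂ) y₁ y₂ - ((A : ℂ) ^ 2) * (qMatT U k * gBox A P.eps⁻¹ U k univ * (qMatT U k)ᴴ) y₁ y₂‖
      ≤ ‖(A : ℂ) * (1 : Matrix _ _ ℂ) y₁ y₂‖ + ‖((A : ℂ) ^ 2) * (qMatT U k * gBox A P.eps⁻¹ U k univ * (qMatT U k)ᴴ) y₁ y₂‖ :=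
        norm_sub_le _ _
    _ ≤ A * (if y₁ = y₂ then 1 else 0) +
          A ^ 2 * (c₀ * P.spacing k ^ 2 * Real.exp (-(δ₀ * Dl / (P.L : ℝ) ^ k)) * ((P.L : ℝ) ^ (k * P.d))⁻¹) := by
        rw [norm_coe_mul_one_apply hA0, norm_mul, norm_pow, Complex.norm_real, Real.norm_eq_abs, abs_of_nonneg hA0]
        exact add_le_add le_rfl (mul_le_mul_of_nonneg_left hSandwich (sq_nonneg _))
    _ = A * ((if y₁ = y₂ then 1 else 0) + B1.aSeq a P.L k * c₀ * Real.exp (-(δ₀ * Dl / (P.L : ℝ) ^ k))) := by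
        have e := scale_identity P a k
        rw [← hAdef] at e
        calc A * (if y₁ = y₂ then 1 else 0) +
              A ^ 2 * (c₀ * P.spacing k ^ 2 * Real.exp (-(δ₀ * Dl / (P.L : ℝ) ^ k)) * ((P.L : ℝ) ^ (k * P.d))⁻¹)
            = A * (if y₁ = y₂ then 1 else 0) +
                A ^ 2 * (((P.L : ℝ) ^ (k * P.d))⁻¹ * P.spacing k ^ 2) * (c₀ * Real.exp (-(δ₀ * Dl / (P.L : ℝ) ^ k))) := by ring
          _ = A * ((if y₁ = y₂ then 1 else 0) + B1.aSeq a P.L k * c₀ * Real.exp (-(δ₀ * Dl / (P.L : ℝ) ^ k))) := by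
              rw [e]; ring
    _ ≤ A * ((if y₁ = y₂ then 1 else 0) +
          B1.aSeq a P.L k * (c₀ * Real.exp δ₀) * Real.exp (-(δ₀ * B5Ineq137Torus.T P (0 + k) y₁ y₂))) := by
        refine mul_le_mul_of_nonneg_left (add_le_add le_rfl ?_) hA0
        calc B1.aSeq a P.L k * c₀ * Real.exp (-(δ₀ * Dl / (P.L : ℝ) ^ k))
            ≤ B1.aSeq a P.L k * c₀ * (Real.exp δ₀ * Real.exp (-(δ₀ * B5Ineq137Torus.T P (0 + k) y₁ y₂))) :=
              mul_le_mul_of_nonneg_left hexp (by positivity)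
          _ = B1.aSeq a P.L k * (c₀ * Real.exp δ₀) * Real.exp (-(δ₀ * B5Ineq137Torus.T P (0 + k) y₁ y₂)) := by ring

end

end Literature.MathematicalPhysics.QuantumFieldTheory.BalabanImbrieJaffe1984to88.BIJ88DeltaRegionSmallField236
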